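import Mathlib.Probability.BrownianMotion.Basic
import Mathlib.Probability.Independence.Basic
import Mathlib.MeasureTheory.Constructions.BorelSpace.Metrizable
import HarnessLib

/-!
# Blumenthal's zero-one law for a Brownian motion with continuous paths

Topic: Probability / stochastic processes. For a pre-Brownian motion `B` (Mathlib
`ProbabilityTheory.IsPreBrownianReal`) on `(Ω, P)` with measurable marginals, *continuous paths*
and `B 0 = 0`, an event `E` which for every `s > 0` coincides almost surely with an event of the
raw natural filtration `𝓕_s = σ(B_j, j ≤ s)` (so, up to null sets, `E` belongs to the germ
σ-field `𝓕_{0+} = ⋂_{s > 0} 𝓕_s`) has probability `0` or `1`: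
`ProbabilityTheory.IsPreBrownianReal.measure_zero_or_one_of_germ` (**proved**).

This is the companion at `t → 0⁺` of the shift form of Kolmogorov's zero-one law at `t → ∞`
(`BrownianZeroOne.lean`, `IsPreBrownianReal.measure_zero_or_one_of_shift`); it is the zero-one
law invoked by Rohde–Schramm (2005) in the proof of Lemma 7.3 (a.s. sealing of the origin by the
SLE_κ hull, `4 < κ < 8`).

Proof (Revuz–Yor, Ch. III, Thm. (2.15); Mörters–Peres, Thm. 2.7): by the weak Markov property
(Mathlib `IsPreBrownianReal.indepFun_shift`) the increment process after time `tₙ = 1/(n+1)`,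
`Gₙ = σ(B(tₙ + u) - B(tₙ), u ≥ 0)`, is independent of `𝓕_{tₙ}`, hence of `E`; the `Gₙ` increase
and form a π-system generating `G = ⨆ₙ Gₙ`; by continuity of the paths and `B 0 = 0`, every
coordinate `B_u = limₙ (B(tₙ + u) - B(tₙ))` is `G`-measurable, so `𝓕_s ≤ G` for every `s` and a
version of `E` is `G`-measurable; so `E` is independent of itself (π-λ, Mathlib
`IndepSets.indep`) and `P E = (P E)²`.

## Mathlib

We USE `ProbabilityTheory.IsPreBrownianReal.indepFun_shift`, `ProbabilityTheory.IndepSets.indep`,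
`IndepFun_iff_Indep`, `Indep_iff`, `IndepSets_iff`, `MeasurableSpace.generateFrom_iUnion_measurableSet`,
`isPiSystem_iUnion_of_monotone`, `measurable_of_tendsto_metrizable`, `ENNReal.mul_eq_left`.
Mathlib has the weak Markov property of pre-Brownian motion but neither Blumenthal's nor (in this
shift form) Kolmogorov's zero-one law (searched `lumenthal`, `zero_or_one`).

## References

* D. Revuz, M. Yor, *Continuous Martingales and Brownian Motion*, 3rd ed., Springer (1999),
  Ch. III, Thm. (2.15) (Blumenthal's zero-one law) and Prop. (3.5) ff.
* P. Mörters, Y. Peres, *Brownian Motion*, Cambridge Univ. Press (2010), Thm. 2.7.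
* R. M. Blumenthal, *An extended Markov property*, Trans. Amer. Math. Soc. 85 (1957) 52–72.
-/

noncomputable section

open Set Filter MeasureTheory ProbabilityTheory Topology
open scoped NNReal ENNReal

namespace Literature.Probability.Process

/-! ### Blumenthal's zero-one law -/

section Blumenthal

variable {Ω : Type*} {mΩ : MeasurableSpace Ω} {P : Measure Ω} {B : ℝ≥0 → Ω → ℝ}

/-- **Blumenthal's zero-one law** (germ σ-field of a Brownian motion). Let `B` be a pre-Brownian
motion with measurable marginals, continuous paths and `B 0 = 0`, and let `E` be an event which,
for every `s > 0`, coincides a.s. with an event of `𝓕_s = σ(B_j, j ≤ s)` (the comap of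
`ω ↦ (B_j ω)_{j ≤ s}`). Then `P E ∈ {0, 1}`. Proof: by the weak Markov property
(Mathlib `IsPreBrownianReal.indepFun_shift`) `E` is independent of the increments after `1/(n+1)`
for every `n`; these σ-algebras increase to one for which, by path continuity and `B 0 = 0`
(`B_u = limₙ (B(1/(n+1) + u) - B(1/(n+1)))`), every `B_u` is measurable, hence which contains a
version of `E`; so `P E = (P E)²` (π-λ). A dot-notation extension of Mathlib's
`ProbabilityTheory.IsPreBrownianReal`, declared in Mathlib's namespace `ProbabilityTheory` (as the
extensions of `BrownianMotion.lean` and `BrownianZeroOne.lean`). Revuz–Yor (1999), Ch. III,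
Thm. (2.15); Mörters–Peres (2010), Thm. 2.7. [cite: RevuzYor1999, Ch. III Thm. (2.15)] -/
theorem _root_.ProbabilityTheory.IsPreBrownianReal.measure_zero_or_one_of_germ
    (hB : IsPreBrownianReal B P) (hm : ∀ t, Measurable (B t))
    (hcont : ∀ ω, Continuous (B · ω)) (h0 : ∀ ω, B 0 ω = 0) {E : Set Ω}
    (hE : ∀ s : ℝ≥0, 0 < s → ∃ E' : Set Ω,
      MeasurableSet[MeasurableSpace.comap (fun ω (j : Iic s) ↦ B j ω) inferInstance] E' ∧
        E =ᵐ[P] E') :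
    P E = 0 ∨ P E = 1 := by
  haveI : IsProbabilityMeasure P := hB.isGaussianProcess.isProbabilityMeasure
  -- the times `t n = 1/(n+1) ↓ 0`
  set t : ℕ → ℝ≥0 := fun n ↦ 1 / ((n : ℝ≥0) + 1) with ht
  have ht_pos : ∀ n, 0 < t n := fun n ↦ by rw [ht]; positivity
  have ht_anti : Antitone t := by
    intro m n hmn
    simp only [ht]
    exact one_div_le_one_div_of_le (by positivity) (by exact_mod_cast Nat.add_le_add_right hmn 1)
  have ht_lim : Tendsto t atTop (𝓝 0) := by
    rw [← NNReal.tendsto_coe]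
    have h : (fun n ↦ ((t n : ℝ≥0) : ℝ)) = fun n : ℕ ↦ 1 / ((n : ℝ) + 1) := by
      funext n; simp [ht]
    rw [h, NNReal.coe_zero]
    exact tendsto_one_div_add_atTop_nhds_zero_nat
  -- the increment processes after `t n` and the σ-algebras they generate
  set sh : ℕ → Ω → (ℝ≥0 → ℝ) := fun n ω u ↦ B (t n + u) ω - B (t n) ω with hsh
  have hsh_meas : ∀ n, Measurable (sh n) := fun n ↦
    measurable_pi_lambda _ fun u ↦ (hm _).sub (hm _)
  set G : ℕ → MeasurableSpace Ω := fun n ↦ MeasurableSpace.comap (sh n) inferInstance with hG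
  have hGle : ∀ n, G n ≤ mΩ := fun n ↦ (hsh_meas n).comap_le
  have hGmono : Monotone G := by
    intro m n hmn
    have hle : t n ≤ t m := ht_anti hmn
    -- `sh m` factors through `sh n`
    set d : ℝ≥0 := t m - t n with hd
    set Φ : (ℝ≥0 → ℝ) → (ℝ≥0 → ℝ) := fun f u ↦ f (d + u) - f d with hΦ
    have hΦm : Measurable Φ :=
      measurable_pi_lambda _ fun u ↦ (measurable_pi_apply _).sub (measurable_pi_apply _)
    have hcomp : sh m = Φ ∘ sh n := by
      funext ω u
      simp only [hΦ, hsh, Function.comp_apply]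
      have h1 : t n + (d + u) = t m + u := by rw [← add_assoc, hd, add_tsub_cancel_of_le hle]
      have h2 : t n + d = t m := by rw [hd, add_tsub_cancel_of_le hle]
      rw [h1, h2]
      ring
    change MeasurableSpace.comap (sh m) inferInstance ≤ MeasurableSpace.comap (sh n) inferInstance
    rw [hcomp, ← MeasurableSpace.comap_comp]
    exact MeasurableSpace.comap_mono hΦm.comap_le
  -- the past σ-algebras and the weak Markov property at `t n`
  set F : ℝ≥0 → MeasurableSpace Ω := fun s ↦
    MeasurableSpace.comap (fun ω (j : Iic s) ↦ B j ω) inferInstance with hF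
  have hind : ∀ n, Indep (G n) (F (t n)) P := fun n ↦
    (IndepFun_iff_Indep _ _ _).1 (hB.indepFun_shift (t n))
  -- `E` is independent of every `G n`-event
  have hprod : ∀ n (C : Set Ω), MeasurableSet[G n] C → P (E ∩ C) = P E * P C := by
    intro n C hC
    obtain ⟨E', hE'meas, hEE'⟩ := hE (t n) (ht_pos n)
    have h1 : P (E ∩ C) = P (C ∩ E') := by
      rw [Set.inter_comm E C]
      exact measure_congr (EventuallyEq.rfl.inter hEE')
    rw [h1, (Indep_iff _ _ _).1 (hind n) _ _ hC hE'meas, measure_congr hEE', mul_comm]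
  -- the π-system `⋃ n, G n` generates `⨆ n, G n`
  set p : Set (Set Ω) := ⋃ n, {C | MeasurableSet[G n] C} with hp
  have hp_pi : IsPiSystem p :=
    isPiSystem_iUnion_of_monotone (fun n ↦ {C | MeasurableSet[G n] C})
      (fun n ↦ @MeasurableSpace.isPiSystem_measurableSet Ω (G n)) (fun m n hmn C hC ↦ hGmono hmn C hC)
  have hp_gen : MeasurableSpace.generateFrom p = ⨆ n, G n :=
    MeasurableSpace.generateFrom_iUnion_measurableSet G
  -- every coordinate `B u = limₙ sh n · u` is `⨆ n, G n`-measurable (continuity, `B 0 = 0`)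
  have hcoord : ∀ u : ℝ≥0, Measurable[⨆ n, G n] (B u) := by
    intro u
    have hf : ∀ n, Measurable[⨆ k, G k] fun ω ↦ sh n ω u := fun n ↦ by
      have h1 : Measurable[G n] fun ω ↦ sh n ω u :=
        (measurable_pi_apply u).comp (comap_measurable (sh n))
      exact h1.mono (le_iSup G n) le_rfl
    refine @measurable_of_tendsto_metrizable Ω ℝ (⨆ k, G k) _ _ _ _ (fun n ω ↦ sh n ω u) (B u) hf ?_
    rw [tendsto_pi_nhds]
    intro ω
    have hc := hcont ω
    have h1 : Tendsto (fun n ↦ B (t n + u) ω) atTop (𝓝 (B (0 + u) ω)) :=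
      (hc.tendsto (0 + u)).comp (ht_lim.add tendsto_const_nhds)
    have h2 : Tendsto (fun n ↦ B (t n) ω) atTop (𝓝 (B 0 ω)) := (hc.tendsto 0).comp ht_lim
    have h3 := h1.sub h2
    rw [zero_add, h0 ω, sub_zero] at h3
    exact h3
  have hFle : ∀ s, F s ≤ ⨆ n, G n := by
    intro s
    have h : Measurable[⨆ n, G n] (fun ω (j : Iic s) ↦ B j ω) :=
      @measurable_pi_lambda Ω (Iic s) (fun _ ↦ ℝ) (⨆ n, G n) _ _ fun j ↦ hcoord j
    exact h.comap_le
  -- a version `E'` of `E` measurable with respect to `⨆ n, G n`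
  obtain ⟨E', hE'F, hEE'⟩ := hE (t 0) (ht_pos 0)
  have hE'tail : MeasurableSet[⨆ n, G n] E' := hFle _ _ hE'F
  have hE'meas : MeasurableSet E' := (iSup_le hGle) _ hE'tail
  -- independence of `σ(E')` and `⨆ n, G n`
  have hindep : Indep (MeasurableSpace.generateFrom {E'}) (⨆ n, G n) P := by
    refine IndepSets.indep (MeasurableSpace.generateFrom_le (by simpa using hE'meas))
      (iSup_le hGle) (IsPiSystem.singleton E') hp_pi rfl hp_gen.symm ?_
    rw [IndepSets_iff]
    rintro s C hs ⟨_, ⟨n, rfl⟩, hC⟩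
    rw [mem_singleton_iff] at hs
    subst hs
    rw [measure_congr (hEE'.symm.inter EventuallyEq.rfl), hprod n C hC, measure_congr hEE']
  have hsq : P E' = P E' * P E' := by
    have := (Indep_iff _ _ _).1 hindep E' E' (MeasurableSpace.measurableSet_generateFrom rfl) hE'tail
    rwa [inter_self] at this
  rw [measure_congr hEE']
  by_cases hzero : P E' = 0
  · exact Or.inl hzero
  · exact Or.inr ((ENNReal.mul_eq_left hzero (measure_ne_top P E')).1 hsq.symm)

end Blumenthal

end Literature.Probability.Process
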